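import Summits.BirchSwinnertonDyer.Rank1Residual.Additive.DisegniLineValues
import Literature.NumberTheory.EllipticCurves.PAdicLFunctionMinus
import HarnessLib

/-!
# STEP A⁻ (odd branch, `p ≡ 3 (mod 4)`): Disegni's interpolation values on the cyclotomic line are
# products of two MINUS Mazur–Tate–Teitelbaum branch values (cell `bsd-addord`, seat `bsd-addord-gz` gen 4)

HONEST FRAMING (cell `bsd-addord`; PARTITION (D-0054): EXCLUDED-DOMAIN additive rows §E, B6 = O7-ord r1 ×
every consumer of hFact, rows `p ≡ 3 (mod 4)` — types-the-object-of; booked 0). THEOREMS ONLY. Odd twin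
of `DisegniLineValues` (STEP A): for `p ≡ 3 (mod 4)` the Legendre character `ε = (·/p)` is ODD, so the
twisting character `ϑ = θ⁻¹ε` of Disegni's value at an even `θ` is odd and Birch's formula is the MINUS
one (tree theorem `ratMinusTwistedSymbolSum_mul_minusPeriod_mul_I`:
`Σ ϑ(a)[a/p^{m+1}]⁻_g · Ω⁻_g · i = τ(ϑ) · L(g, ϑ̄, 1)`). Hence

  `cycLineValue ι α θ Car (L₁ L₂) = c⁻ · v⁻_f(χ_θ) · v⁻_{f′}(χ_θ)`,  `c⁻ := ι⁻¹(−u · Car · Ω⁻_f · Ω⁻_{f′})`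

(`i² = −1`), with `v⁻_g(κ) = α^{−(m+1)} Σ_a κ(a) ω(a)^{(p−1)/2} [a/p^{m+1}]⁻_g` EXACTLY the right-hand side
of the tree's minus interpolation theorem `hasSum_padicLMinusBranchCoeff_mul_pow_of_isPrimitive`.

References: [Disegni2017] Thm. A (arXiv v3 PDF 7–8); [MazurTateTeitelbaum1986Invent] §I.8 (8.6), §I.13,
§I.14 (14.3).
-/

set_option autoImplicit false

noncomputable section

open scoped Classical MatrixGroups ModularForm NumberField

open CongruenceSubgroup WeierstrassCurve Literature.NumberTheory.EllipticCurves
  Literature.NumberTheory.EllipticCurves.ModularForms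
  Literature.NumberTheory.EllipticCurves.Disegni2017

namespace Summit.BirchSwinnertonDyer.Rank1Residual.Additive

section TransportMinus

variable {p : ℕ} [hp : Fact p.Prime] (ι : PadicAlgCl p ≃+* ℂ)

/-- **`ι⁻¹` of the complex MINUS symbol sum `Σ_b (θ⁻¹ε)(b)[b/p^{m+1}]⁻_f` is the Mazur–Tate–Teitelbaum
minus sum `Σ_b χ_θ(b)·ω(b)^{(p−1)/2}·[b/p^{m+1}]⁻_f` in `ℂ_p`** (odd twin of `coe_symm_ratTwistedSymbolSum`).
[cite: MazurTateTeitelbaum1986Invent, §I.13–I.14 (14.3)] [cite: Disegni2017, Theorem A (arXiv v3 PDF 7–8)] -/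
theorem coe_symm_ratMinusTwistedSymbolSum (hp2 : p ≠ 2) {N : ℕ} (f : CuspForm (Gamma0 N) 2) {m : ℕ}
    (hm : cyclotomicExponent p ≤ m + 1) (θ : DirichletCharacter ℂ (p ^ (m + 1))) :
    ((ι.symm (ratMinusTwistedSymbolSum f (θ⁻¹ * legendreLevel p (m + 1) (Nat.succ_ne_zero m))) :
        PadicAlgCl p) : ℂ_[p]) =
      ∑ b : ZMod (p ^ (m + 1)),
        ((θ⁻¹.ringHomComp ι.symm.toRingHom).ringHomComp (algebraMap (PadicAlgCl p) ℂ_[p])) b *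
          algebraMap ℚ_[p] ℂ_[p] (teichWeight p (p / 2)
            (ZMod.castHom (pow_dvd_pow p hm) (ZMod (p ^ cyclotomicExponent p)) b)) *
          (ratMinusSymbol f ((b.val : ℚ) / ((p ^ (m + 1) : ℕ) : ℚ)) : ℂ_[p]) := by
  rw [ratMinusTwistedSymbolSum, map_sum, PadicComplex.coe_eq, map_sum]
  refine Finset.sum_congr rfl fun b _ ↦ ?_
  rw [MulChar.coeToFun_mul, Pi.mul_apply, legendreLevel_apply p, teichWeight_half_castHom p hp2 hm,
    map_mul, map_mul, map_mul, map_mul, MulChar.ringHomComp_apply, MulChar.ringHomComp_apply,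
    map_intCast, map_intCast, map_ratCast, map_ratCast, map_intCast]
  push_cast
  rfl

end TransportMinus

section MainOdd

variable {p : ℕ} [hp : Fact p.Prime] (ι : PadicAlgCl p ≃+* ℂ)

/-- For `p ≡ 3 (mod 4)` the Legendre character is odd: `ε(−1) = (−1/p) = −1`. -/
theorem legendreLevel_neg_one_of_mod_four_eq_three (hp4 : p % 4 = 3) {n : ℕ} (hn : n ≠ 0) :
    legendreLevel p n hn (-1) = -1 := by
  have hpP : p.Prime := hp.out
  have hp2 : p ≠ 2 := by intro h; rw [h] at hp4; norm_num at hp4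
  haveI : NeZero (p ^ n) := ⟨pow_ne_zero _ hpP.ne_zero⟩
  have hlt : 1 < p ^ n := Nat.one_lt_pow hn hpP.one_lt
  haveI : Fact (1 < p ^ n) := ⟨hlt⟩
  rw [legendreLevel_apply p hn]
  have hneg : (-1 : ZMod (p ^ n)).val = p ^ n - 1 := by
    rw [ZMod.neg_val, if_neg one_ne_zero, ZMod.val_one]
  have hval : ((-1 : ZMod (p ^ n)).val : ℤ) = (p : ℤ) ^ n - 1 := by
    rw [hneg, Nat.cast_sub hlt.le]
    push_cast
    ring
  have key : ((p : ℤ) ^ n - 1) % (p : ℤ) = (-1 : ℤ) % (p : ℤ) := by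
    have hdvd : (p : ℤ) ∣ ((p : ℤ) ^ n - 1) - (-1) := by
      rw [sub_neg_eq_add, sub_add_cancel]
      exact dvd_pow_self (p : ℤ) hn
    have hmod : (-1 : ℤ) ≡ (p : ℤ) ^ n - 1 [ZMOD (p : ℤ)] := Int.modEq_iff_dvd.mpr hdvd
    exact hmod.symm
  rw [hval, legendreSym.mod, key, ← legendreSym.mod, legendreSym.at_neg_one hp2,
    ZMod.χ₄_nat_three_mod_four hp4, Int.cast_neg, Int.cast_one]

/-- **STEP A⁻ — Disegni's interpolation value on the cyclotomic line is a constant times the product of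
two MINUS Mazur–Tate–Teitelbaum branch values** (`p ≡ 3 (mod 4)`, odd branch `ω^{(p−1)/2}`). For two
rational newforms `f, f′`, an even character `θ` mod `p^{m+1}` of `p`-power order, primitive unless
`m = 0`, and entire continuations `Λ₁`, `Λ₂` of `L(f ⊗ θε, s)`, `L(f′ ⊗ θε, s)`:
`cycLineValue ι α θ Car (Λ₁(1)·Λ₂(1)) = ι⁻¹(−u · Car · Ω⁻_f · Ω⁻_{f′}) · v⁻_f(χ_θ) · v⁻_{f′}(χ_θ)`.
[cite: Disegni2017, Theorem A (arXiv v3 PDF 7–8)] [cite: MazurTateTeitelbaum1986Invent, §I.8 (8.6), §I.14 (14.3)] -/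
theorem cycLineValue_eq_const_mul_minusBranchValues (hp4 : p % 4 = 3) {m : ℕ}
    (hm : cyclotomicExponent p ≤ m + 1)
    (θ : DirichletCharacter ℂ (p ^ (m + 1))) (heven : θ.Even) (hord : ∃ j : ℕ, orderOf θ = p ^ j)
    (hprim : θ.IsPrimitive ∨ m = 0)
    {N N' : ℕ} [NeZero N] [NeZero N'] {f : CuspForm (Gamma0 N) 2} {f' : CuspForm (Gamma0 N') 2}
    (hf : IsNewform0 f) (hQ : coeffField f = ⊥) (hf' : IsNewform0 f') (hQ' : coeffField f' = ⊥)
    (α : ℚ_[p]) (Car : ℝ) {Λ₁ Λ₂ : ℂ → ℂ} (hΛ₁ : Differentiable ℂ Λ₁)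
    (hΛ₁' : ∀ s : ℂ, 2 < s.re →
      Λ₁ s = twistedLSeries f (θ * legendreLevel p (m + 1) (Nat.succ_ne_zero m)) s)
    (hΛ₂ : Differentiable ℂ Λ₂)
    (hΛ₂' : ∀ s : ℂ, 2 < s.re →
      Λ₂ s = twistedLSeries f' (θ * legendreLevel p (m + 1) (Nat.succ_ne_zero m)) s) :
    cycLineValue ι α θ Car (Λ₁ 1 * Λ₂ 1) =
      ((ι.symm (-(splitLocalConstant p : ℂ) * (Car : ℂ) * (minusPeriod f : ℂ) * (minusPeriod f' : ℂ)) :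
          PadicAlgCl p) : ℂ_[p]) *
        (algebraMap ℚ_[p] ℂ_[p] (α⁻¹ ^ (m + 1)) *
          ∑ b : ZMod (p ^ (m + 1)),
            ((θ⁻¹.ringHomComp ι.symm.toRingHom).ringHomComp (algebraMap (PadicAlgCl p) ℂ_[p])) b *
              algebraMap ℚ_[p] ℂ_[p] (teichWeight p (p / 2)
                (ZMod.castHom (pow_dvd_pow p hm) (ZMod (p ^ cyclotomicExponent p)) b)) *
              (ratMinusSymbol f ((b.val : ℚ) / ((p ^ (m + 1) : ℕ) : ℚ)) : ℂ_[p])) *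
        (algebraMap ℚ_[p] ℂ_[p] (α⁻¹ ^ (m + 1)) *
          ∑ b : ZMod (p ^ (m + 1)),
            ((θ⁻¹.ringHomComp ι.symm.toRingHom).ringHomComp (algebraMap (PadicAlgCl p) ℂ_[p])) b *
              algebraMap ℚ_[p] ℂ_[p] (teichWeight p (p / 2)
                (ZMod.castHom (pow_dvd_pow p hm) (ZMod (p ^ cyclotomicExponent p)) b)) *
              (ratMinusSymbol f' ((b.val : ℚ) / ((p ^ (m + 1) : ℕ) : ℚ)) : ℂ_[p])) := by
  have hpP : p.Prime := hp.out
  have hp2 : p ≠ 2 := by intro h; rw [h] at hp4; norm_num at hp4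
  set ε := legendreLevel p (m + 1) (Nat.succ_ne_zero m) with hε
  set ϑ := θ⁻¹ * ε with hϑ
  -- parity of `ϑ`: odd
  have hεinv : ε⁻¹ = ε := legendreLevel_inv p (Nat.succ_ne_zero m)
  have hϑodd : ϑ.Odd := by
    rw [DirichletCharacter.Odd, hϑ, MulChar.coeToFun_mul, Pi.mul_apply, MulChar.inv_apply_eq_inv',
      heven, inv_one, one_mul, hε, legendreLevel_neg_one_of_mod_four_eq_three hp4]
  -- primitivity of `ϑ`
  have hϑprim : ϑ.IsPrimitive := by
    rcases Nat.eq_zero_or_pos m with hm0 | hmpos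
    · subst hm0
      have hθ1 : θ = 1 := eq_one_of_orderOf_eq_prime_pow_level_prime p hord
      rw [hϑ, hθ1, inv_one, one_mul, hε]
      exact legendreLevel_one_isPrimitive p hp2
    · have hθ : θ.IsPrimitive := hprim.resolve_right (by omega)
      exact isPrimitive_inv_mul_legendreLevel p hmpos hθ
  -- odd Birch for `f` and `f′` at `ϑ` (`ϑ⁻¹ = θ ε`)
  have hϑinv : ϑ⁻¹ = θ * ε := by rw [hϑ, mul_inv, inv_inv, hεinv]
  have hB₁ := ratMinusTwistedSymbolSum_mul_minusPeriod_mul_I f hf hQ hϑprim hϑodd hΛ₁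
    (fun s hs ↦ by rw [hϑinv]; exact hΛ₁' s hs)
  have hB₂ := ratMinusTwistedSymbolSum_mul_minusPeriod_mul_I f' hf' hQ' hϑprim hϑodd hΛ₂
    (fun s hs ↦ by rw [hϑinv]; exact hΛ₂' s hs)
  -- the complex identity (`i² = −1`)
  have hC : cycLineComplexPart (p := p) θ Car (Λ₁ 1 * Λ₂ 1) =
      (-(splitLocalConstant p : ℂ) * (Car : ℂ) * (minusPeriod f : ℂ) * (minusPeriod f' : ℂ)) *
        ratMinusTwistedSymbolSum f ϑ * ratMinusTwistedSymbolSum f' ϑ := by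
    rw [cycLineComplexPart, ← hε, ← hϑ]
    calc (splitLocalConstant p : ℂ) * gaussSum ϑ (ZMod.stdAddChar (N := p ^ (m + 1))) ^ 2 * (Car : ℂ) *
          (Λ₁ 1 * Λ₂ 1)
        = (splitLocalConstant p : ℂ) * (Car : ℂ) *
            (gaussSum ϑ (ZMod.stdAddChar (N := p ^ (m + 1))) * Λ₁ 1) *
            (gaussSum ϑ (ZMod.stdAddChar (N := p ^ (m + 1))) * Λ₂ 1) := by ring
      _ = (splitLocalConstant p : ℂ) * (Car : ℂ) *
            (ratMinusTwistedSymbolSum f ϑ * (minusPeriod f : ℂ) * Complex.I) *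
            (ratMinusTwistedSymbolSum f' ϑ * (minusPeriod f' : ℂ) * Complex.I) := by rw [hB₁, hB₂]
      _ = (splitLocalConstant p : ℂ) * (Car : ℂ) * (minusPeriod f : ℂ) * (minusPeriod f' : ℂ) *
            ratMinusTwistedSymbolSum f ϑ * ratMinusTwistedSymbolSum f' ϑ * (Complex.I * Complex.I) := by
          ring
      _ = _ := by rw [Complex.I_mul_I]; ring
  -- transport to `ℂ_p`
  rw [cycLineValue, hC, map_mul, map_mul, PadicComplex.coe_eq, map_mul, map_mul, ← PadicComplex.coe_eq,
    ← PadicComplex.coe_eq, ← PadicComplex.coe_eq, hϑ, hε, coe_symm_ratMinusTwistedSymbolSum ι hp2 f hm θ,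
    coe_symm_ratMinusTwistedSymbolSum ι hp2 f' hm θ, pow_mul', sq, map_mul]
  ring

end MainOdd

end Summit.BirchSwinnertonDyer.Rank1Residual.Additive

end
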